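import Summits.RiemannHypothesis.RiemannHypothesis.Theorems.TwoPrimeFoldRigidity.Negative.TensorReduction
import Summits.RiemannHypothesis.RiemannHypothesis.Theorems.TwoPrimeFoldRigidity.Negative.MomentBlindTower

/-!
# Refutation of `IntegerScrew.TwoPrimeFoldRigidity` (item stmt-RiemannHypothesis-25784, support statement K1)

HONEST LABEL.  Record-negative programme; 0 toward RH.  RH is not proved, not used, not mentioned below.  This
refutes a SUPPORT statement of route IntegerScrew (the two-prime fold rigidity K1), i.e. it is negative knowledge
about the sampling set `ℕ⁺ log 2 ∪ ℕ⁺ log 3` of the screw functional; nothing here bears on the truth of RH.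

CLASS: `refuted-substantive`.  K1 asserts that NO nonempty admissible configuration (`m_i > 0`,
`0 < Re κ_i < 1/2`, `Im κ_i > 1`, locally finite, `Σ m/Im² < ∞`) has both prime folds
`k ↦ Σ_i 4 m_i Re((cosh(κ_i k log p) − 1)/κ_i²)`, `p = 2, 3`, bounded on `k ≥ 1`.  WITNESS: the tensor product
(`Negative/TensorReduction`) of two ONE-lattice moment-blind towers (`Negative/MomentBlindTower`, steps `log 2` and
`log 3`, abscissae `↑ 1/4` not attained): on `P × Q`, `κ_{pq} = κ_p + κ'_q`, `m_{pq} = μ_p ν_q |κ_{pq}|⁴/4`; the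
growing part of either fold is a finite combination of products of one-lattice moment sums of orders `0,1,2`, one
factor of which vanishes identically on that lattice, and the rest is absolutely bounded.  No Diophantine input:
the same product kills every pair (indeed every finite set) of steps, so the mechanism's load-bearing claim — that
two multiplicatively independent lattices together see every admissible configuration — is false.
NO CHEAP REPAIR: (i) shrinking the strip (`Re κ < δ`) — the towers live in `Re κ < 1/4` and rescale to any `δ > 0`;
(ii) more primes / all integers `k ≥ 1` of several lattices — tensor more towers, one per lattice;
(iii) stronger decay (`Σ m |κ|^N < ∞`) — the tower budget `E_m = O((m+1)⁻⁴)` can be pushed to any polynomial rate by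
raising `L = 20`; what WOULD repair it is sampling on a set that is not a finite union of lattices (e.g. all real
`t ≥ 1`, where the sup-not-attained/almost-periodicity argument of `ScrewLatticeSupB1` bites), which is a different
statement.  barrier-candidate: "finite unions of arithmetic sampling lattices are blind to positive Dirichlet-type
configurations with unattained abscissa supremum (tensor products of one-lattice moment-blind towers)".
-/

namespace Summit.RiemannHypothesis.RiemannHypothesis.Theorems

open Summit.RiemannHypothesis.RiemannHypothesis.Theorems.TwoPrimeFoldRigidity.Negative in
/-- Refutes `IntegerScrew.TwoPrimeFoldRigidity` [refuted-substantive]: there IS a nonempty admissible configuration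
(positive masses, `0 < Re κ < 1/2`, `Im κ > 1`, locally finite, `Σ m/Im² < ∞`) whose `log 2`- and `log 3`-folds are
both bounded on the positive integers; witness = tensor product of the one-lattice moment-blind towers for `log 2`
and `log 3` (`momentBlindTower_exists`) via `twoPrimeFoldRigidity_false_of_towers`; no cheap repair (any finite set
of lattice steps, any strip width, any polynomial mass decay is killed the same way); repaired statement would have
to sample a non-lattice set (different statement). [folklore-free; construction of this tree] -/
theorem IntegerScrewTwoPrimeFoldRigidity_refuted :
    ¬ Summit.RiemannHypothesis.RiemannHypothesis.Theses.IntegerScrew.TwoPrimeFoldRigidity := by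
  obtain ⟨P, μ, κ, hne, hμ, hre, him, hfin, hsum, hbl⟩ :=
    MBT.momentBlindTower_exists (Real.log 2) (Real.log_pos one_lt_two)
  obtain ⟨Q, ν, κ', hne', hν, hre', him', hfin', hsum', hbl'⟩ :=
    MBT.momentBlindTower_exists (Real.log 3) (Real.log_pos (by norm_num))
  exact twoPrimeFoldRigidity_false_of_towers hne hne' μ κ ν κ' hμ hre him hfin hsum hbl hν hre' him' hfin' hsum' hbl'

end Summit.RiemannHypothesis.RiemannHypothesis.Theorems
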